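import Mathlib.Algebra.BigOperators.Finprod
import Mathlib.RingTheory.Ideal.MinimalPrime.Localization
import Mathlib.RingTheory.Localization.AtPrime.Basic
import Mathlib.RingTheory.Localization.Away.Basic
import Mathlib.RingTheory.RegularLocalRing.Defs
import Literature.AlgebraicGeometry.Resolution.RegularLocalRingsProofs
import Literature.NumberTheory.GaloisRepresentations.CrystallineDeformationRing
import Literature.NumberTheory.GaloisRepresentations.LabelledHodgeTateWeights
import HarnessLib

/-!
# Kisin: crystalline deformation rings of fixed Hodge type exist and have formally smooth,
# equidimensional generic fibre; "connects" is an equivalence relation (BLGGT §1.4)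

Trunk: GaloisRepresentations (cite item `wi-10107` of route WachCensus of the summit `Langlands`,
the glue `ComponentCensusUnram → PD2Unram`).

## Mathematics (as printed)

Let `K/ℚ_p` be finite, `L/ℚ_p` finite inside `ℚ̄_p` containing the image of every `τ : K ↪ ℚ̄_p`,
`𝒪 = 𝒪_L`, `𝔽 = 𝒪/λ`, `ρ̄ : Γ_K → GL_n(𝔽)` continuous and `{H_τ}` a family of multisets of
integers indexed by `τ ∈ Hom_{ℚ_p}(K, ℚ̄_p)`.

* [BLGGT] §1.4 (p. 13 of arXiv:1010.2561): `R^□_{𝒪,ρ̄}` has a quotient `R^□_{𝒪,ρ̄,{H_τ},cris}`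
  "uniquely characterized by requiring that [it is] reduced without `l`-torsion and that a
  `ℚ̄_l`-point of `R^□_{𝒪,ρ̄}` factors through [it] if and only if it corresponds to a
  representation `ρ : G_K → GL_n(ℚ̄_l)` which is de Rham with Hodge–Tate numbers `HT_τ(ρ) = H_τ`
  for all `τ : K ↪ ℚ̄_l` and which [is crystalline]"; it is Kisin's `R^{□,v}_{cr}` (Kisin 2008,
  (3.3.3): the framed ring `R^□_{V_𝔽}`; Cor. (2.7.7): the quotient of `A = A°[1/p]` through which
  a map to a finite `E`-algebra `B` factors iff `V_B` is potentially crystalline of Galois type `τ`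
  and `p`-adic Hodge type `v` — here `τ` trivial). In the tree this quotient is the INTERFACE
  `CrystallineDeformationRing p K 𝒪_L k_L ρ̄ 𝔇 H` (file `CrystallineDeformationRing`) with the
  Hodge-type condition `H = 𝔇.HasHodgeType v` defined here (`HT_τ(ρ) = v_τ` for every
  `ℚ_p`-embedding `τ`, via the accepted `PeriodRingData.labelledHodgeTateWeights`).
* Kisin 2008, Thm. (3.3.8) (p. 535): "`Spec (R^□_{V_𝔽}[1/p])^{τ,v}_{cr}` is formally smooth and
  equi-dimensional of dimension `d² + dim_E adD_{E,K}/Fil⁰ adD_{E,K}`." Here `d = n` and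
  `D_{E,K} = D_E ⊗_{ℚ_p} K` "carries the filtration giving rise to `v`" ((3.3.3)); for
  `E ⊇ τ(K)` (all `τ`), `D_{E,K} = ⊕_τ D_τ` and `dim_E adD_τ/Fil⁰ adD_τ = Σ_{a<b} m_τ(a)m_τ(b)`,
  `m_τ(a)` the multiplicity of the weight `a` in `v_τ` — the dimension of the partial flag variety
  `GL_n/P_{v_τ}`, equal to `n(n-1)/2` for multiplicity-free `v_τ`, whence [BLGGT] §1.4: "If
  `H_τ` has `n` distinct elements for each `τ` then each ring `R^□_{𝒪,ρ̄,{H_τ},*}` is either zero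
  or equidimensional of dimension `1 + n² + [K:ℚ_l]n(n-1)/2`". "Formally smooth" is meant in
  Kisin's sense (proof of (3.3.8): "the completion of `Spec (R^□_{V_𝔽}[1/p])^{τ,v}_{cr}` at any
  maximal ideal ... is formally smooth"): the complete local rings at the closed points are
  formally smooth over `E` for their adic topology (power series rings over finite extensions of
  `E`). By Matsumura §28 Lemma 1 (an `𝔪`-smooth noetherian local `k`-algebra is regular, and
  conversely when the residue field is separable over `k` — automatic in characteristic `0`) and
  Serre's localisation theorem (Matsumura Thm. 19.3) this is EQUIVALENT to: `R[1/p]` is a regular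
  ring (Mathlib `IsRegularRing`). It is NOT Mathlib's discrete `Algebra.FormallySmooth`
  (Matsumura §28 Remark: `k[[X₁,…,X_n]]` is `0`-smooth over `k` only if `char k = p` and
  `[k:k^p] < ∞`).
* [BLGGT] §1.4 (p. 13): "Each of the schemes `Spec R^□_{𝒪,ρ̄,{H_τ},cris}[1/l]` and ... are
  formally smooth"; (p. 14) "'Connects' is an equivalence relation. (Because
  `R^□_{𝒪,ρ̄_i,{H_τ},K'-cris}[1/l]` is formally smooth.)" — i.e. every closed point of
  `Spec (R^□_{ρ̄,{H_τ},cris} ⊗ ℚ̄_l)` lies on a unique irreducible component (the notion of §1.3,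
  definition of *strongly connects*), which makes "define points on a common irreducible
  component" transitive.

## What this file provides

As in `CrystallineDeformationRing`, Kisin's theorems are PREDICATES on the `p`-adic Hodge datum
`𝔇 : PstWeilDeligneData K p` (consumers hypothesize them about the datum in scope) and ONE named
fact records that the genuine datum has them:

* `hodgeTypeFlagDim w = Σ_{a<b} m(a)m(b) = dim GL_n/P_w` (Kisin's `dim_E adD_τ/Fil⁰ adD_τ`);
  PROVED `hodgeTypeFlagDim_of_nodup` (regular case: `n(n-1)/2`, [BLGGT]'s number).
* `PstWeilDeligneData.HasHodgeType 𝔇 v ρ` — `HT_τ(ρ) = v τ` for every `τ : K →ₐ[ℚ_p] ℚ̄_p`;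
  `PstWeilDeligneData.crystallineGenericFibreDim 𝔇 n v = n² + Σ_τ hodgeTypeFlagDim (v τ)`.
* `PstWeilDeligneData.HasHodgeTypeCrystallineDeformationRings 𝔇` — EXISTENCE (Kisin (3.3.3),
  Cor. (2.7.7); [BLGGT] §1.4 `* = cris`): for `L ⊇ τ(K)`, `ρ̄`, `v` such that `ρ̄` has a
  crystalline lift of Hodge type `v`, the type
  `CrystallineDeformationRing p K 𝒪_L k_L ρ̄ 𝔇 (𝔇.HasHodgeType v)` is `Nonempty`.
* `PstWeilDeligneData.CrystallineGenericFibreRegular 𝔇` — Kisin Thm. (3.3.8): for every such ring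
  `𝓡`, `𝓡.R[1/p]` is a regular ring and every irreducible component (minimal prime `𝔮`) has
  `dim 𝓡.R[1/p]/𝔮 = crystallineGenericFibreDim 𝔇 n v`.
* `PstWeilDeligneData.CrystallinePointsOnUniqueComponent 𝔇` — [BLGGT] §1.4: every `ℚ̄_p`-point of
  such an `𝓡` lies on a unique irreducible component of `Spec (𝓡.R ⊗_𝒪 ℚ̄_p)`
  (`genericFibreComponents`, `pointQbar` of the interface).
* PROVED: `CrystallinePointsOnUniqueComponent.equivalence_onCommonComponent` ("'connects' is an
  equivalence relation": `𝓡.OnCommonComponent` is an `Equivalence`);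
  `sup_eq_top_of_mem_minimalPrimes_of_isDomain_localization` (if every `A_𝔪` is a domain then
  distinct minimal primes of `A` are comaximal) and hence
  `CrystallineGenericFibreRegular.sup_eq_top_of_mem_minimalPrimes` ("the irreducible components of
  `Spec R[1/p]` are its connected components"; uses the tree's `isDomain_of_isRegularLocalRing`,
  Matsumura Thm. 14.3); `CrystallineGenericFibreRegular.ringKrullDim_quotient_of_nodup`.
* Named fact (D-0014) `Kisin2007_crystallineDeformationRings`: the genuine datum exists with the
  given `ℚ_p`-algebra structure and has `UnramifiedWeightsZero`, `HasCrystallineDeformationRings`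
  (the accepted fact `CrystallineDeformationRing.nonempty`, refined: PROVED
  `CrystallineDeformationRing.nonempty_of_kisin2007`) and the three properties above.

## Why predicates "for every instance `𝓡`" are faithful

An instance `𝓡 : CrystallineDeformationRing p K 𝒪_L k_L ρ̄ 𝔇 H` is a complete noetherian local
`𝒪_L`-algebra with residue field `k_L`, reduced and `p`-torsion free, topologically generated by
the entries of its lifting (so `R^□_{𝒪_L,ρ̄} → 𝓡.R` is surjective: a local map of complete local
noetherian rings, bijective on residue fields, with dense image is onto, by Nakayama), whose
`ℚ̄_p`-points are exactly the crystalline lifts of Hodge type `v`. As `R^□[1/p]` is Jacobson with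
closed points the Galois orbits of `ℚ̄_p`-points, two reduced `p`-torsion-free quotients of `R^□`
with the same `ℚ̄_p`-points coincide ([BLGGT] §1.4 "uniquely characterized"); so for the genuine
datum every instance IS `R^□_{𝒪_L,ρ̄,{v_τ},cris}` and Kisin's / [BLGGT]'s statements hold for all
instances (and if no crystalline lift of type `v` exists there is no instance). The standing
hypothesis `L ⊇ τ(K)` of [BLGGT] §1.4 is kept in all three predicates.

## References

* M. Kisin, *Potentially semi-stable deformation rings*, J. Amer. Math. Soc. 21 (2008), 513–546:
  (2.6), (2.7.5), Cor. (2.7.7) (p. 528), (3.3.3), Thm. (3.3.4) (p. 534), Thm. (3.3.8) (p. 535).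
  [Kisin2007]
* [BLGGT] T. Barnet-Lamb, T. Gee, D. Geraghty, R. Taylor, *Potential automorphy and change of
  weight*, Ann. of Math. 179 (2014), §1.3 (p. 12), §1.4 (pp. 13–14) of arXiv:1010.2561.
  [BarnetlambEtAl2014]
* H. Matsumura, *Commutative Ring Theory* (CUP 1986), Thm. 14.3, Thm. 19.3, §28 Lemma 1 and
  Remark, Thm. 28.7. [Matsumura1987]
-/

noncomputable section

open scoped MatrixGroups TensorProduct
open Field IsLocalRing

namespace Literature.NumberTheory.GaloisRepresentations

/-! ### The dimension of the partial flag variety of a Hodge type -/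

/-- **`dim GL_n/P_w`** for a multiset `w` of `n` integers (a labelled Hodge type at one embedding):
the number of `2`-element sub-multisets of `w` with DISTINCT entries, i.e. `Σ_{a<b} m(a)·m(b)`
where `m(a)` is the multiplicity of `a` in `w` — the number of pairs of positions carrying distinct
weights. This is `dim_E (ad D/Fil⁰ ad D)` for a filtered `E`-vector space `D` with
`dim gr^a D = m(a)` (`ad D = End D`, `Fil⁰ ad D` = filtration-preserving endomorphisms, so
`ad D/Fil⁰ ad D ≅ ⊕_{b<a} Hom(gr^a D, gr^b D)`), the summand at one embedding `τ` of the dimension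
`dim_E adD_{E,K}/Fil⁰ adD_{E,K}` in Kisin's Thm. (3.3.4)/(3.3.8); for `w` multiplicity-free it is
`n(n-1)/2` (`hodgeTypeFlagDim_of_nodup`), the number in [BLGGT] §1.4.
[cite: Kisin2007, (3.3.3) and Thm. 3.3.8] -/
def hodgeTypeFlagDim (w : Multiset ℤ) : ℕ :=
  Multiset.card ((w.powersetCard 2).filter Multiset.Nodup)

/-- Unfolding lemma for `hodgeTypeFlagDim`. [folklore] -/
lemma hodgeTypeFlagDim_def (w : Multiset ℤ) :
    hodgeTypeFlagDim w = Multiset.card ((w.powersetCard 2).filter Multiset.Nodup) := rfl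

/-- **Regular Hodge type**: if the `n` weights are pairwise distinct then
`hodgeTypeFlagDim w = n(n-1)/2 = dim GL_n/B` ([BLGGT] §1.4: dimension
`1 + n² + [K:ℚ_l]n(n-1)/2` of `R^□_{𝒪,ρ̄,{H_τ},*}` when each `H_τ` has `n` distinct elements).
[cite: BarnetlambEtAl2014, §1.4] -/
theorem hodgeTypeFlagDim_of_nodup {w : Multiset ℤ} (h : w.Nodup) :
    hodgeTypeFlagDim w = (Multiset.card w).choose 2 := by
  rw [hodgeTypeFlagDim_def, Multiset.filter_eq_self.2, Multiset.card_powersetCard]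
  intro t ht
  exact Multiset.nodup_of_le (Multiset.mem_powersetCard.1 ht).1 h

/-- `hodgeTypeFlagDim 0 = 0` (no weights). [folklore] -/
@[simp] lemma hodgeTypeFlagDim_zero : hodgeTypeFlagDim 0 = 0 := by
  rw [hodgeTypeFlagDim_of_nodup Multiset.nodup_zero, Multiset.card_zero]
  decide

/-! ### Commutative algebra: locally integral rings have comaximal minimal primes -/

section CommAlg

variable {A : Type*} [CommRing A]

/-- If the localisation `A_𝔪` at a maximal ideal `𝔪` is a domain, then at most one minimal prime
of `A` is contained in `𝔪` (the minimal primes of `A` inside `𝔪` extend to the minimal primes of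
`A_𝔪`, Mathlib `IsLocalization.minimalPrimes_map`, and a domain has the single minimal prime `0`).
[folklore] -/
theorem eq_of_mem_minimalPrimes_of_isDomain_localization (𝔪 : Ideal A) [𝔪.IsMaximal]
    [IsDomain (Localization.AtPrime 𝔪)] {𝔮₁ 𝔮₂ : Ideal A} (h₁ : 𝔮₁ ∈ minimalPrimes A)
    (h₂ : 𝔮₂ ∈ minimalPrimes A) (hle₁ : 𝔮₁ ≤ 𝔪) (hle₂ : 𝔮₂ ≤ 𝔪) : 𝔮₁ = 𝔮₂ := by
  -- the extensions of `𝔮ᵢ` to `A_𝔪` are minimal primes of the domain `A_𝔪`, hence both `⊥`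
  have key : ∀ {𝔮 : Ideal A}, 𝔮 ∈ minimalPrimes A → 𝔮 ≤ 𝔪 →
      𝔮 = (⊥ : Ideal (Localization.AtPrime 𝔪)).under A := by
    intro 𝔮 h𝔮 hle
    haveI : 𝔮.IsPrime := h𝔮.1.1
    have hdisj : Disjoint (𝔪.primeCompl : Set A) 𝔮 := by
      rw [Set.disjoint_left]
      intro a ha ha'
      exact ha (hle ha')
    have hunder := IsLocalization.under_map_of_isPrime_disjoint 𝔪.primeCompl
      (Localization.AtPrime 𝔪) ‹𝔮.IsPrime› hdisj
    have hmap : Ideal.map (algebraMap A (Localization.AtPrime 𝔪)) 𝔮 ∈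
        minimalPrimes (Localization.AtPrime 𝔪) := by
      have hmin := IsLocalization.minimalPrimes_map 𝔪.primeCompl (Localization.AtPrime 𝔪)
        (⊥ : Ideal A)
      rw [Ideal.map_bot] at hmin
      change Ideal.map (algebraMap A (Localization.AtPrime 𝔪)) 𝔮 ∈
        (⊥ : Ideal (Localization.AtPrime 𝔪)).minimalPrimes
      rw [hmin, Set.mem_preimage, hunder]
      exact h𝔮
    rw [IsDomain.minimalPrimes_eq_singleton_bot, Set.mem_singleton_iff] at hmap
    rw [← hmap, hunder]
  exact (key h₁ hle₁).trans (key h₂ hle₂).symm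

/-- **Locally integral ⇒ irreducible components are connected components.** If `A_𝔪` is a domain
for every maximal ideal `𝔪` of `A` (e.g. `A` regular: a regular local ring is a domain,
Matsumura Thm. 14.3), then two distinct minimal primes of `A` are comaximal, `𝔮₁ + 𝔮₂ = A`; so
the irreducible components `V(𝔮ᵢ)` of `Spec A` are pairwise disjoint, hence (being finitely many
when `A` is noetherian) they are the connected components. [folklore] -/
theorem sup_eq_top_of_mem_minimalPrimes_of_isDomain_localization
    (hA : ∀ (𝔪 : Ideal A) [𝔪.IsMaximal], IsDomain (Localization.AtPrime 𝔪))
    {𝔮₁ 𝔮₂ : Ideal A} (h₁ : 𝔮₁ ∈ minimalPrimes A) (h₂ : 𝔮₂ ∈ minimalPrimes A) (hne : 𝔮₁ ≠ 𝔮₂) :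
    𝔮₁ ⊔ 𝔮₂ = ⊤ := by
  by_contra hlt
  obtain ⟨𝔪, h𝔪, hle⟩ := Ideal.exists_le_maximal (𝔮₁ ⊔ 𝔮₂) hlt
  haveI := hA 𝔪
  exact hne (eq_of_mem_minimalPrimes_of_isDomain_localization 𝔪 h₁ h₂
    (le_sup_left.trans hle) (le_sup_right.trans hle))

/-- In a regular ring (Mathlib `IsRegularRing`: noetherian, all localisations at primes regular
local) two distinct minimal primes are comaximal — regular local rings are domains
(`Literature.AlgebraicGeometry.Resolution.isDomain_of_isRegularLocalRing`, Matsumura Thm. 14.3).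
[cite: Matsumura1987, Thm. 14.3] -/
theorem sup_eq_top_of_mem_minimalPrimes_of_isRegularRing [IsRegularRing A]
    {𝔮₁ 𝔮₂ : Ideal A} (h₁ : 𝔮₁ ∈ minimalPrimes A) (h₂ : 𝔮₂ ∈ minimalPrimes A) (hne : 𝔮₁ ≠ 𝔮₂) :
    𝔮₁ ⊔ 𝔮₂ = ⊤ :=
  sup_eq_top_of_mem_minimalPrimes_of_isDomain_localization
    (fun 𝔪 _ => Literature.AlgebraicGeometry.Resolution.isDomain_of_isRegularLocalRing
      (Localization.AtPrime 𝔪)) h₁ h₂ hne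

end CommAlg

/-! ### Hodge types -/

section Pst

variable {K : Type} [Field K] [ValuativeRel K] [TopologicalSpace K] [IsNonarchimedeanLocalField K]
  {p : ℕ} [Fact p.Prime] {n : ℕ}

namespace PstWeilDeligneData

/-- **`ρ : Γ_K → GL_n(ℚ̄_p)` has labelled Hodge type `v`** relative to the datum `𝔇` (its
`ℚ_p`-algebra structure on `K` and its period ring `𝔇.𝔅`, intended `B_dR(K)`): for every
`ℚ_p`-algebra embedding `τ : K →ₐ[ℚ_p] ℚ̄_p` the multiset of `τ`-labelled Hodge–Tate weights
`HT_τ(ρ)` (accepted `PeriodRingData.labelledHodgeTateWeights`, computed `ℚ̄_p`-linearly on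
`ℚ̄_p^n ⊗_{ℚ_p} B`, as in the accepted global wrapper `labelledHodgeTateWeightsAt`) equals `v τ`.
The family `v` is indexed by bare ring homomorphisms `K →+* ℚ̄_p` (so that its type does not
depend on `𝔇`); only its values at `ℚ_p`-algebra embeddings matter ([BLGGT]:
`τ ∈ Hom_{ℚ_l}(K, ℚ̄_l)`, "de Rham with Hodge–Tate numbers `HT_τ(ρ) = H_τ` for all `τ`"; Kisin:
"of `p`-adic Hodge type `v`", (2.6), (2.7.5)).
[cite: BarnetlambEtAl2014, §1.4] [cite: Kisin2007, (2.6) and (2.7.5)] -/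
def HasHodgeType (𝔇 : PstWeilDeligneData K p) (v : (K →+* PadicAlgCl p) → Multiset ℤ)
    (ρ : FramedRep (absoluteGaloisGroup K) (PadicAlgCl p) n) : Prop :=
  letI := 𝔇.algebra
  ∀ τ : K →ₐ[ℚ_[p]] PadicAlgCl p,
    𝔇.𝔅.labelledHodgeTateWeights (FramedRep.toContinuousRep ρ) τ.toRingHom = v τ.toRingHom

/-- Unfolding lemma for `HasHodgeType`. [folklore] -/
lemma hasHodgeType_iff (𝔇 : PstWeilDeligneData K p) (v : (K →+* PadicAlgCl p) → Multiset ℤ)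
    (ρ : FramedRep (absoluteGaloisGroup K) (PadicAlgCl p) n) :
    𝔇.HasHodgeType v ρ ↔
      letI := 𝔇.algebra
      ∀ τ : K →ₐ[ℚ_[p]] PadicAlgCl p,
        𝔇.𝔅.labelledHodgeTateWeights (FramedRep.toContinuousRep ρ) τ.toRingHom =
          v τ.toRingHom :=
  Iff.rfl

/-- Two families agreeing on `ℚ_p`-algebra embeddings define the same Hodge-type condition.
[folklore] -/
lemma hasHodgeType_congr (𝔇 : PstWeilDeligneData K p) {v v' : (K →+* PadicAlgCl p) → Multiset ℤ}
    (h : letI := 𝔇.algebra; ∀ τ : K →ₐ[ℚ_[p]] PadicAlgCl p, v τ.toRingHom = v' τ.toRingHom)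
    (ρ : FramedRep (absoluteGaloisGroup K) (PadicAlgCl p) n) :
    𝔇.HasHodgeType v ρ ↔ 𝔇.HasHodgeType v' ρ :=
  forall_congr' fun τ => by rw [h τ]

/-- **Kisin's dimension** `n² + dim_E adD_{E,K}/Fil⁰ adD_{E,K}` of the generic fibre of the framed
crystalline deformation ring of rank `n` and Hodge type `v` (Thm. (3.3.8)), in the form
`n² + Σ_τ dim GL_n/P_{v_τ}` (`hodgeTypeFlagDim`; the sum over the `ℚ_p`-algebra embeddings
`τ : K →ₐ[ℚ_p] ℚ̄_p` is a `finsum`, equal to the finite sum as `Hom_{ℚ_p}(K, ℚ̄_p)` is finite).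
For regular `v` this is `n² + [K:ℚ_p] n(n-1)/2` ([BLGGT] §1.4). [cite: Kisin2007, Thm. 3.3.8] -/
def crystallineGenericFibreDim (𝔇 : PstWeilDeligneData K p) (n : ℕ)
    (v : (K →+* PadicAlgCl p) → Multiset ℤ) : ℕ :=
  letI := 𝔇.algebra
  n ^ 2 + ∑ᶠ τ : K →ₐ[ℚ_[p]] PadicAlgCl p, hodgeTypeFlagDim (v τ.toRingHom)

/-- Unfolding lemma for `crystallineGenericFibreDim`. [folklore] -/
lemma crystallineGenericFibreDim_def (𝔇 : PstWeilDeligneData K p) (n : ℕ)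
    (v : (K →+* PadicAlgCl p) → Multiset ℤ) :
    𝔇.crystallineGenericFibreDim n v =
      letI := 𝔇.algebra
      n ^ 2 + ∑ᶠ τ : K →ₐ[ℚ_[p]] PadicAlgCl p, hodgeTypeFlagDim (v τ.toRingHom) :=
  rfl

/-- The generic fibre has dimension at least `n²` (the framing variables). [folklore] -/
lemma sq_le_crystallineGenericFibreDim (𝔇 : PstWeilDeligneData K p) (n : ℕ)
    (v : (K →+* PadicAlgCl p) → Multiset ℤ) : n ^ 2 ≤ 𝔇.crystallineGenericFibreDim n v :=
  Nat.le_add_right _ _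

/-! ### Kisin's theorems as predicates on the datum -/

/-- **The datum `𝔇` admits crystalline deformation rings of every labelled Hodge type** (Kisin;
[BLGGT] §1.4, `* = cris`). For every finite `L/ℚ_p` inside `ℚ̄_p` containing the image of every
`ℚ_p`-embedding `τ : K → ℚ̄_p` ([BLGGT] §1.4, standing assumption), with integers `𝒪_L` and
residue field `k_L` (discrete), every continuous `ρ̄ : Γ_K → GL_n(k_L)` and every family `v` of
multisets of integers indexed by the embeddings such that `ρ̄` has at least one continuous lift
`Γ_K → GL_n(𝒪_{ℚ̄_p})` which is `𝔇`-crystalline of Hodge type `v` (otherwise the quotient in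
question is the zero ring, [BLGGT] §1.4 "either zero or ..."), the reduced `p`-torsion-free
quotient of `R^□_{𝒪_L,ρ̄}` whose `ℚ̄_p`-points are the crystalline lifts of `ρ̄` of Hodge type `v`
— [BLGGT]'s `R^□_{𝒪,ρ̄,{v_τ},cris}`, Kisin's `R^{□,v}_{cr}` ((3.3.3) with Cor. (2.7.7), trivial
Galois type) — exists as a (non-zero) complete noetherian local ring:
`CrystallineDeformationRing p K 𝒪_L k_L ρ̄ 𝔇 (𝔇.HasHodgeType v)` is inhabited. A PREDICATE on the
datum (cf. the accepted interval form `HasCrystallineDeformationRings`); asserted of the genuine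
datum by the named fact `Kisin2007_crystallineDeformationRings`.
[cite: Kisin2007, (3.3.3) and Cor. 2.7.7] [cite: BarnetlambEtAl2014, §1.4] -/
def HasHodgeTypeCrystallineDeformationRings (𝔇 : PstWeilDeligneData K p) : Prop :=
  ∀ (L : IntermediateField ℚ_[p] (PadicAlgCl p)) [FiniteDimensional ℚ_[p] L],
    letI := 𝔇.algebra
    (∀ (τ : K →ₐ[ℚ_[p]] PadicAlgCl p) (a : K), τ a ∈ L) →
    ∀ (n : ℕ),
    letI := intermediateFieldIntegers.algebraPadicAlgCl L
    letI : TopologicalSpace (ResidueField (intermediateFieldIntegers p L)) := ⊥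
    ∀ (ρbar : FramedRep (absoluteGaloisGroup K) (ResidueField (intermediateFieldIntegers p L)) n)
      (v : (K →+* PadicAlgCl p) → Multiset ℤ),
      (∃ ρ : FramedRep (absoluteGaloisGroup K) (PadicAlgCl p) n,
          ReducesTo (intermediateFieldIntegers p L) ρ.toMonoidHom ρbar.toMonoidHom ∧
            𝔇.IsCrystallineFramed ρ ∧ 𝔇.HasHodgeType v ρ) →
      Nonempty (CrystallineDeformationRing p K (intermediateFieldIntegers p L)
        (ResidueField (intermediateFieldIntegers p L)) ρbar 𝔇 (𝔇.HasHodgeType v))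

/-- **Kisin, Thm. (3.3.8): the generic fibre of the crystalline deformation ring is formally
smooth and equidimensional**, as a predicate on the datum `𝔇`. For every finite `L/ℚ_p` inside
`ℚ̄_p` containing all `τ(K)`, every `ρ̄ : Γ_K → GL_n(k_L)`, every Hodge type `v` and every
crystalline deformation ring `𝓡 = R^□_{𝒪_L,ρ̄,{v_τ},cris}` (any instance of the interface; all
are isomorphic, see the module docstring), writing `A = 𝓡.R[1/p]` (`Localization.Away p`):
(i) "`Spec A` is formally smooth" over `L` in Kisin's sense (completed local rings at closed
points are power series rings over finite extensions of `L`), EQUIVALENTLY (Matsumura §28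
Lemma 1, Thm. 19.3; characteristic `0`) `A` is a regular ring — Mathlib `IsRegularRing A`; and
(ii) `Spec A` is "equi-dimensional of dimension `d² + dim_E adD_{E,K}/Fil⁰ adD_{E,K}`": for every
minimal prime `𝔮` of `A` (irreducible component), `dim A/𝔮 = crystallineGenericFibreDim 𝔇 n v
= n² + Σ_τ hodgeTypeFlagDim (v τ)`. Printed: "`Spec (R^□_{V_𝔽}[1/p])^{τ,v}_{cr}` is formally
smooth and equi-dimensional of dimension `d² + dim_E adD_{E,K}/Fil⁰ adD_{E,K}`" (here with
trivial Galois type `τ`); [BLGGT] §1.4: "Each of the schemes `Spec R^□_{𝒪,ρ̄,{H_τ},cris}[1/l]` ...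
are formally smooth." Asserted of the genuine datum by `Kisin2007_crystallineDeformationRings`.
[cite: Kisin2007, Thm. 3.3.8] [cite: BarnetlambEtAl2014, §1.4] [cite: Matsumura1987, §28 Lemma 1] -/
def CrystallineGenericFibreRegular (𝔇 : PstWeilDeligneData K p) : Prop :=
  ∀ (L : IntermediateField ℚ_[p] (PadicAlgCl p)) [FiniteDimensional ℚ_[p] L],
    letI := 𝔇.algebra
    (∀ (τ : K →ₐ[ℚ_[p]] PadicAlgCl p) (a : K), τ a ∈ L) →
    ∀ (n : ℕ),
    letI := intermediateFieldIntegers.algebraPadicAlgCl L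
    letI : TopologicalSpace (ResidueField (intermediateFieldIntegers p L)) := ⊥
    ∀ (ρbar : FramedRep (absoluteGaloisGroup K) (ResidueField (intermediateFieldIntegers p L)) n)
      (v : (K →+* PadicAlgCl p) → Multiset ℤ)
      (𝓡 : CrystallineDeformationRing p K (intermediateFieldIntegers p L)
        (ResidueField (intermediateFieldIntegers p L)) ρbar 𝔇 (𝔇.HasHodgeType v)),
      IsRegularRing (Localization.Away (p : 𝓡.R)) ∧
        ∀ 𝔮 ∈ minimalPrimes (Localization.Away (p : 𝓡.R)),
          ringKrullDim (Localization.Away (p : 𝓡.R) ⧸ 𝔮) =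
            (𝔇.crystallineGenericFibreDim n v : ℕ)

/-- **[BLGGT] §1.4: every `ℚ̄_p`-point of a crystalline deformation ring of fixed Hodge type lies
on a unique irreducible component of its geometric generic fibre**, as a predicate on the datum
`𝔇`: for `L ⊇ τ(K)`, `ρ̄`, `v` and `𝓡 = R^□_{𝒪_L,ρ̄,{v_τ},cris}` as above and every `ℚ̄_p`-point
`x : 𝓡.R → ℚ̄_p`, exactly one minimal prime of `ℚ̄_p ⊗_{𝒪_L} 𝓡.R` (`genericFibreComponents`) is
contained in the kernel of `x̄ : ℚ̄_p ⊗ 𝓡.R → ℚ̄_p` (`pointQbar`). This is the content of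
"'Connects' is an equivalence relation. (Because `R^□_{𝒪,ρ̄_i,{H_τ},K'-cris}[1/l]` is formally
smooth.)" ([BLGGT] §1.4, p. 14; §1.3: "`ρ₁` lies on a unique irreducible component of
`Spec (R^□_{ρ̄₁} ⊗ ℚ̄_l)`", the condition under which `∼` composes), here for the ring `* = cris`,
stated by [BLGGT] to be formally smooth as well; PROVED consequence:
`CrystallinePointsOnUniqueComponent.equivalence_onCommonComponent`. Asserted of the genuine
datum by `Kisin2007_crystallineDeformationRings`.
[cite: BarnetlambEtAl2014, §1.3–1.4] [cite: Kisin2007, Thm. 3.3.8] -/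
def CrystallinePointsOnUniqueComponent (𝔇 : PstWeilDeligneData K p) : Prop :=
  ∀ (L : IntermediateField ℚ_[p] (PadicAlgCl p)) [FiniteDimensional ℚ_[p] L],
    letI := 𝔇.algebra
    (∀ (τ : K →ₐ[ℚ_[p]] PadicAlgCl p) (a : K), τ a ∈ L) →
    ∀ (n : ℕ),
    letI := intermediateFieldIntegers.algebraPadicAlgCl L
    letI : TopologicalSpace (ResidueField (intermediateFieldIntegers p L)) := ⊥
    ∀ (ρbar : FramedRep (absoluteGaloisGroup K) (ResidueField (intermediateFieldIntegers p L)) n)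
      (v : (K →+* PadicAlgCl p) → Multiset ℤ)
      (𝓡 : CrystallineDeformationRing p K (intermediateFieldIntegers p L)
        (ResidueField (intermediateFieldIntegers p L)) ρbar 𝔇 (𝔇.HasHodgeType v))
      (x : 𝓡.R →ₐ[intermediateFieldIntegers p L] PadicAlgCl p),
      ∃! 𝔮, 𝔮 ∈ 𝓡.genericFibreComponents ∧ 𝔮 ≤ RingHom.ker (𝓡.pointQbar x)

/-! ### Proved consequences -/

variable {𝔇 : PstWeilDeligneData K p} (L : IntermediateField ℚ_[p] (PadicAlgCl p))
  [FiniteDimensional ℚ_[p] L]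

/-- **"'Connects' is an equivalence relation"** ([BLGGT] §1.4): on the `ℚ̄_p`-points of a
crystalline deformation ring of fixed Hodge type, "lie on a common irreducible component of
`Spec (R ⊗ ℚ̄_p)`" (`OnCommonComponent`) is reflexive, symmetric and — because every point lies on
a unique component (`CrystallinePointsOnUniqueComponent`) — transitive.
[cite: BarnetlambEtAl2014, §1.4] -/
theorem CrystallinePointsOnUniqueComponent.equivalence_onCommonComponent
    (h : 𝔇.CrystallinePointsOnUniqueComponent)
    (hL : letI := 𝔇.algebra; ∀ (τ : K →ₐ[ℚ_[p]] PadicAlgCl p) (a : K), τ a ∈ L) :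
    letI := intermediateFieldIntegers.algebraPadicAlgCl L
    letI : TopologicalSpace (ResidueField (intermediateFieldIntegers p L)) := ⊥
    ∀ (ρbar : FramedRep (absoluteGaloisGroup K) (ResidueField (intermediateFieldIntegers p L)) n)
      (v : (K →+* PadicAlgCl p) → Multiset ℤ)
      (𝓡 : CrystallineDeformationRing p K (intermediateFieldIntegers p L)
        (ResidueField (intermediateFieldIntegers p L)) ρbar 𝔇 (𝔇.HasHodgeType v)),
      Equivalence 𝓡.OnCommonComponent := by
  letI := intermediateFieldIntegers.algebraPadicAlgCl L
  letI : TopologicalSpace (ResidueField (intermediateFieldIntegers p L)) := ⊥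
  intro ρbar v 𝓡
  refine ⟨fun x => 𝓡.onCommonComponent_self x, fun hxy => hxy.symm, ?_⟩
  intro x y z hxy hyz
  obtain ⟨𝔮₁, h𝔮₁, hx, hy⟩ := hxy
  obtain ⟨𝔮₂, h𝔮₂, hy', hz⟩ := hyz
  obtain ⟨𝔮, -, huniq⟩ := h L hL n ρbar v 𝓡 y
  have e₁ : 𝔮₁ = 𝔮 := huniq 𝔮₁ ⟨h𝔮₁, hy⟩
  have e₂ : 𝔮₂ = 𝔮 := huniq 𝔮₂ ⟨h𝔮₂, hy'⟩
  exact ⟨𝔮₁, h𝔮₁, hx, by rw [e₁, ← e₂]; exact hz⟩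

/-- Under `CrystallinePointsOnUniqueComponent`, two points lie on a common component iff THE
component of one contains the other. [cite: BarnetlambEtAl2014, §1.4] -/
theorem CrystallinePointsOnUniqueComponent.onCommonComponent_iff
    (h : 𝔇.CrystallinePointsOnUniqueComponent)
    (hL : letI := 𝔇.algebra; ∀ (τ : K →ₐ[ℚ_[p]] PadicAlgCl p) (a : K), τ a ∈ L) :
    letI := intermediateFieldIntegers.algebraPadicAlgCl L
    letI : TopologicalSpace (ResidueField (intermediateFieldIntegers p L)) := ⊥
    ∀ (ρbar : FramedRep (absoluteGaloisGroup K) (ResidueField (intermediateFieldIntegers p L)) n)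
      (v : (K →+* PadicAlgCl p) → Multiset ℤ)
      (𝓡 : CrystallineDeformationRing p K (intermediateFieldIntegers p L)
        (ResidueField (intermediateFieldIntegers p L)) ρbar 𝔇 (𝔇.HasHodgeType v))
      (x y : 𝓡.R →ₐ[intermediateFieldIntegers p L] PadicAlgCl p),
      𝓡.OnCommonComponent x y ↔
        ∀ 𝔮 ∈ 𝓡.genericFibreComponents, 𝔮 ≤ RingHom.ker (𝓡.pointQbar x) →
          𝔮 ≤ RingHom.ker (𝓡.pointQbar y) := by
  letI := intermediateFieldIntegers.algebraPadicAlgCl L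
  letI : TopologicalSpace (ResidueField (intermediateFieldIntegers p L)) := ⊥
  intro ρbar v 𝓡 x y
  obtain ⟨𝔮₀, ⟨h𝔮₀, hx₀⟩, huniq⟩ := h L hL n ρbar v 𝓡 x
  constructor
  · rintro ⟨𝔮, h𝔮, hx, hy⟩ 𝔮' h𝔮' hx'
    rw [huniq 𝔮' ⟨h𝔮', hx'⟩, ← huniq 𝔮 ⟨h𝔮, hx⟩]
    exact hy
  · intro H
    exact ⟨𝔮₀, h𝔮₀, hx₀, H 𝔮₀ h𝔮₀ hx₀⟩

/-- **"The irreducible components of `Spec R[1/p]` are its connected components"**: under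
`CrystallineGenericFibreRegular`, two distinct minimal primes of the regular ring `𝓡.R[1/p]` are
comaximal (so the irreducible components are pairwise disjoint, hence open and closed).
Consequence of Kisin's Thm. (3.3.8) and Matsumura Thm. 14.3. [cite: Kisin2007, Thm. 3.3.8] -/
theorem CrystallineGenericFibreRegular.sup_eq_top_of_mem_minimalPrimes
    (h : 𝔇.CrystallineGenericFibreRegular)
    (hL : letI := 𝔇.algebra; ∀ (τ : K →ₐ[ℚ_[p]] PadicAlgCl p) (a : K), τ a ∈ L) :
    letI := intermediateFieldIntegers.algebraPadicAlgCl L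
    letI : TopologicalSpace (ResidueField (intermediateFieldIntegers p L)) := ⊥
    ∀ (ρbar : FramedRep (absoluteGaloisGroup K) (ResidueField (intermediateFieldIntegers p L)) n)
      (v : (K →+* PadicAlgCl p) → Multiset ℤ)
      (𝓡 : CrystallineDeformationRing p K (intermediateFieldIntegers p L)
        (ResidueField (intermediateFieldIntegers p L)) ρbar 𝔇 (𝔇.HasHodgeType v))
      (𝔮₁ 𝔮₂ : Ideal (Localization.Away (p : 𝓡.R))),
      𝔮₁ ∈ minimalPrimes (Localization.Away (p : 𝓡.R)) →
        𝔮₂ ∈ minimalPrimes (Localization.Away (p : 𝓡.R)) → 𝔮₁ ≠ 𝔮₂ → 𝔮₁ ⊔ 𝔮₂ = ⊤ := by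
  letI := intermediateFieldIntegers.algebraPadicAlgCl L
  letI : TopologicalSpace (ResidueField (intermediateFieldIntegers p L)) := ⊥
  intro ρbar v 𝓡 𝔮₁ 𝔮₂ h₁ h₂ hne
  haveI : IsRegularRing (Localization.Away (p : 𝓡.R)) := (h L hL n ρbar v 𝓡).1
  exact sup_eq_top_of_mem_minimalPrimes_of_isRegularRing h₁ h₂ hne

/-- Under `CrystallineGenericFibreRegular`, the local ring of `Spec 𝓡.R[1/p]` at every prime is a
regular local ring, in particular a domain. [cite: Kisin2007, Thm. 3.3.8] -/
theorem CrystallineGenericFibreRegular.isDomain_localization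
    (h : 𝔇.CrystallineGenericFibreRegular)
    (hL : letI := 𝔇.algebra; ∀ (τ : K →ₐ[ℚ_[p]] PadicAlgCl p) (a : K), τ a ∈ L) :
    letI := intermediateFieldIntegers.algebraPadicAlgCl L
    letI : TopologicalSpace (ResidueField (intermediateFieldIntegers p L)) := ⊥
    ∀ (ρbar : FramedRep (absoluteGaloisGroup K) (ResidueField (intermediateFieldIntegers p L)) n)
      (v : (K →+* PadicAlgCl p) → Multiset ℤ)
      (𝓡 : CrystallineDeformationRing p K (intermediateFieldIntegers p L)
        (ResidueField (intermediateFieldIntegers p L)) ρbar 𝔇 (𝔇.HasHodgeType v))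
      (𝔭 : Ideal (Localization.Away (p : 𝓡.R))) [𝔭.IsPrime],
      IsDomain (Localization.AtPrime 𝔭) := by
  letI := intermediateFieldIntegers.algebraPadicAlgCl L
  letI : TopologicalSpace (ResidueField (intermediateFieldIntegers p L)) := ⊥
  intro ρbar v 𝓡 𝔭 _
  haveI : IsRegularRing (Localization.Away (p : 𝓡.R)) := (h L hL n ρbar v 𝓡).1
  exact Literature.AlgebraicGeometry.Resolution.isDomain_of_isRegularLocalRing
    (Localization.AtPrime 𝔭)

/-- Under `CrystallineGenericFibreRegular`, for a REGULAR Hodge type (`v τ` multiplicity-free of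
cardinality `n` at every embedding) every irreducible component of `Spec 𝓡.R[1/p]` has dimension
`n² + Σ_τ n(n-1)/2` ([BLGGT] §1.4: `R^□_{𝒪,ρ̄,{H_τ},*}` "either zero or equidimensional of
dimension `1 + n² + [K:ℚ_l]n(n-1)/2`"; the `1 +` is the dimension of `𝒪`).
[cite: BarnetlambEtAl2014, §1.4] -/
theorem CrystallineGenericFibreRegular.ringKrullDim_quotient_of_nodup
    (h : 𝔇.CrystallineGenericFibreRegular)
    (hL : letI := 𝔇.algebra; ∀ (τ : K →ₐ[ℚ_[p]] PadicAlgCl p) (a : K), τ a ∈ L) :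
    letI := intermediateFieldIntegers.algebraPadicAlgCl L
    letI : TopologicalSpace (ResidueField (intermediateFieldIntegers p L)) := ⊥
    letI := 𝔇.algebra
    ∀ (ρbar : FramedRep (absoluteGaloisGroup K) (ResidueField (intermediateFieldIntegers p L)) n)
      (v : (K →+* PadicAlgCl p) → Multiset ℤ),
      (∀ τ : K →ₐ[ℚ_[p]] PadicAlgCl p,
          (v τ.toRingHom).Nodup ∧ Multiset.card (v τ.toRingHom) = n) →
      ∀ (𝓡 : CrystallineDeformationRing p K (intermediateFieldIntegers p L)
        (ResidueField (intermediateFieldIntegers p L)) ρbar 𝔇 (𝔇.HasHodgeType v)),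
      ∀ 𝔮 ∈ minimalPrimes (Localization.Away (p : 𝓡.R)),
        ringKrullDim (Localization.Away (p : 𝓡.R) ⧸ 𝔮) =
          (n ^ 2 + ∑ᶠ _τ : K →ₐ[ℚ_[p]] PadicAlgCl p, n.choose 2 : ℕ) := by
  letI := intermediateFieldIntegers.algebraPadicAlgCl L
  letI : TopologicalSpace (ResidueField (intermediateFieldIntegers p L)) := ⊥
  letI := 𝔇.algebra
  intro ρbar v hv 𝓡 𝔮 h𝔮
  have hsum : (∑ᶠ τ : K →ₐ[ℚ_[p]] PadicAlgCl p, hodgeTypeFlagDim (v τ.toRingHom)) =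
      ∑ᶠ _τ : K →ₐ[ℚ_[p]] PadicAlgCl p, n.choose 2 :=
    finsum_congr fun τ => by rw [hodgeTypeFlagDim_of_nodup (hv τ).1, (hv τ).2]
  rw [(h L hL n ρbar v 𝓡).2 𝔮 h𝔮, crystallineGenericFibreDim_def, hsum]

end PstWeilDeligneData

/-! ### The named fact: Kisin's theorems for the genuine datum -/

/-- **Kisin's crystalline deformation rings (existence, and formally smooth equidimensional
generic fibre) for the genuine `p`-adic Hodge datum.** For every finite extension `K` of `ℚ_p`
(every non-archimedean local field of characteristic zero, as a `ℚ_p`-algebra) there is a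
`p`-adic Hodge datum `𝔇 : PstWeilDeligneData K p` with the given `ℚ_p`-algebra structure —
INTENDED: Fontaine's `B_dR(K)` and `WD ∘ D_pst`, as in the accepted `PstWeilDeligneData.nonempty`
and `CrystallineDeformationRing.nonempty`, both of which this fact refines
(`CrystallineDeformationRing.nonempty_of_kisin2007`) — such that: unramified representations have
Hodge–Tate weights `0` (`UnramifiedWeightsZero`, Fontaine); crystalline deformation rings with
weights in an interval exist (`HasCrystallineDeformationRings`, Kisin, Theorem of the
Introduction / Thm. (2.5.5), Cor. (2.7.7)); crystalline deformation rings of every labelled Hodge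
type `{v_τ}` exist (`HasHodgeTypeCrystallineDeformationRings`: Kisin (3.3.3), Cor. (2.7.7);
[BLGGT] §1.4); their generic fibres `R[1/p]` are formally smooth (= regular) and equidimensional
of dimension `n² + dim_E adD_{E,K}/Fil⁰ adD_{E,K} = n² + Σ_τ dim GL_n/P_{v_τ}`
(`CrystallineGenericFibreRegular`: Kisin Thm. (3.3.8)); and every `ℚ̄_p`-point lies on a unique
irreducible component of `Spec (R ⊗_𝒪 ℚ̄_p)`, so that "connects" is an equivalence relation
(`CrystallinePointsOnUniqueComponent`: [BLGGT] §1.4). Consumers holding a datum `𝔇` in scope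
(e.g. `ReciprocityData.pst`) hypothesize the predicates directly; this named fact (D-0014)
records that the genuine datum has them.
[cite: Kisin2007, Cor. 2.7.7, (3.3.3) and Thm. 3.3.8] [cite: BarnetlambEtAl2014, §1.4] -/
def Kisin2007_crystallineDeformationRings : Prop :=
  ∀ (K : Type) [Field K] [ValuativeRel K] [TopologicalSpace K] [IsNonarchimedeanLocalField K]
    (p : ℕ) [Fact p.Prime] [CharZero K] (_ : Algebra ℚ_[p] K),
    ∃ 𝔇 : PstWeilDeligneData K p, 𝔇.algebra = ‹Algebra ℚ_[p] K› ∧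
      𝔇.UnramifiedWeightsZero ∧ 𝔇.HasCrystallineDeformationRings ∧
        𝔇.HasHodgeTypeCrystallineDeformationRings ∧ 𝔇.CrystallineGenericFibreRegular ∧
          𝔇.CrystallinePointsOnUniqueComponent

/-- `Kisin2007_crystallineDeformationRings` refines the accepted named fact
`CrystallineDeformationRing.nonempty` (existence of the datum with the interval-form rings).
[cite: Kisin2007, Introduction, Thm. 2.5.5 and Cor. 2.7.7] -/
theorem CrystallineDeformationRing.nonempty_of_kisin2007
    (h : Kisin2007_crystallineDeformationRings) : CrystallineDeformationRing.nonempty := by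
  intro K _ _ _ _ p _ _ alg
  obtain ⟨𝔇, h𝔇, h0, h1, -, -, -⟩ := h K p alg
  exact ⟨𝔇, h𝔇, h0, h1⟩

/-- `Kisin2007_crystallineDeformationRings` refines the accepted named fact
`PstWeilDeligneData.nonempty` (existence of the genuine datum). [cite: Kisin2007, Thm. 3.3.8] -/
theorem PstWeilDeligneData.nonempty_of_kisin2007
    (h : Kisin2007_crystallineDeformationRings) : PstWeilDeligneData.nonempty := by
  intro K _ _ _ _ p _ _ alg
  obtain ⟨𝔇, h𝔇, -⟩ := h K p alg
  exact ⟨𝔇, h𝔇⟩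

end Pst

end Literature.NumberTheory.GaloisRepresentations

end
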